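import Literature.Probability.LatticeModels.ClusterExpansionKPBound
import Summits.QuantumFields.YangMills.Theorems.BalabanLadderIRTwistedSlabTorusCovering
import HarnessLib

/-!
# Torus doubling for polymer gases: `log Ξ(ℤ_{kn} × Y) - k · log Ξ(ℤ_n × Y)` is exponentially small in `n` (K47c)

HELPER toward stub **T1** `TwistedSlabAnchor` of LINE `twisted-slab-continuity` (crux `IRcof`,
stmt-QuantumFields-26930, census row 43; LEAD prover ym-ir-line-tsc-p1 g7; `--supports` the crux, `--as helper`):
brick **(m6)** of the M4 anatomy of memo `Cruxes/IRcof/T1-ANATOMY-tsc-p1.md` §16.3 — the TORUS FINITE-SIZE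
bookkeeping of a Kotecký–Preiss polymer expansion of `log projSlabZ`, done model-free on the tree's PROVED KP layer
(`Literature/Probability/LatticeModels/{ClusterExpansion, ClusterExpansionKPBound, PolymerPressure}`), so that an
eventual M4 line only has to produce the polymer representation ((m1)(m2)(m4)(m5)) and read off
`|log Ξ_{2t} − 2 log Ξ_t| ≤ A·t·L·e^{−ct}`. Nothing here is specific to gauge theory; T1 is NOT advanced by this file
alone (HONEST: T1 0∕1 = M4 + hcl; the Yang–Mills mass gap is NOT proved).

The finite-size ("periodic boundary conditions") companion of the Kotecký–Preiss bulk free energy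
formula ([KP86], p. 493, translation-invariant case; `PolymerPressure.lean` for boxes of `ℤ^d`):
for a gas of subset polymers on the discrete torus/cylinder `X_N = ℤ_N × Y` (`ZMod N × Y`, `Y`
any finite set carrying everything that is not the periodic "time" direction) in the
Kotecký–Preiss regime, comparing the `k`-fold cover `X_{kn}` with `X_n` along the covering map
`(t, y) ↦ (t mod n, y)`:

* `norm_polymerLogZ_sub_mul_polymerLogZ_le`: if the activities `w₂` on `X_{kn}` and `w₁` on `X_n`
  AGREE ALONG THE COVERING on every polymer whose times lie in an arc of `ℓ` consecutive times,
  `2ℓ ≤ n` (`IsTimeShort ℓ`; locality of the activities), are supported on non-empty polymers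
  whose time projection is connected at range `r` (`IsTimeConnected r`), and satisfy hypothesis
  (1) of [KP86] with `d(A) ≥ δ|A|`, then
  `‖log Ξ(X_{kn}; w₂) - k · log Ξ(X_n; w₁)‖ ≤ e^{-δℓ/(2r)} (Σ_{x ∈ X_{kn}} a₂{x} + k Σ_{x ∈ X_n} a₁{x})`,
  i.e. `≤ 2kn|Y|α e^{-δℓ/(2r)}` for `a{x} = α`.

Mechanism (all on proved declarations of `ClusterExpansion.lean` / `PolymerPressure.lean` and of K47a/K47b):
`log Ξ = Σ_C Φ^T(C)` over families of polymers ([KP86, (2)], `polymerLogZ_eq_sum_truncatedWeight`);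
the families with non-empty `ℓ`-short support upstairs and downstairs correspond EXACTLY `k : 1`
under the covering (`filter_projFam_eq_image`: a short set upstairs lies in one sheet because
`2ℓ ≤ n`, `exists_sheet_of_isTimeShort`, and is then the lift `liftFam c C` of its projection),
with `Φ^T` preserved (`truncatedWeight_image`, `truncatedWeight_liftFam`), whence
`sum_truncatedWeight_short_eq`; every other family with `Φ^T ≠ 0` is a cluster ([KP86, Theorem])
of non-empty time-connected polymers meeting each other, so its support is time-connected
(`isTimeConnected_clusterSupp`) and not short, hence has at least `ℓ/(2r)` distinct times
(`le_card_times_of_not_isTimeShort`) and `d`-size `≥ δℓ/(2r)`; the Kotecký–Preiss estimate (4)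
anchored at the one-site polymers prices these winding/long clusters
(`sum_norm_truncatedWeight_le_exp_neg_of_touches`, `norm_sum_truncatedWeight_long_le`).

This is the shape "the periodic free energy has exponentially small finite-size corrections" of
Borgs–Kotecký (1990) and of Assumption B(2) of Biskup–Borgs–Chayes–Kleinwaks–Kotecký (2004)
(`|log ζ_m^{(L)} - log ζ_m| ≤ e^{-τL}`), here for one phase and in doubling form
(`k = 2`: `log Ξ_{2n} - 2 log Ξ_n`), in which winding/long clusters are the ONLY difference
between the `2n`-torus and two `n`-tori (no bulk term, no term linear in `n` survives).
Everything in this file is PROVED; no named facts.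

## References

* [KP86] R. Kotecký, D. Preiss, Comm. Math. Phys. 103 (1986) 491–498, Theorem p. 492 and
  p. 493 (translation invariant case). [KoteckyPreiss1986]
* C. Borgs, R. Kotecký, J. Stat. Phys. 61 (1990) 79–119, §1 (periodic boundary conditions:
  exponentially small finite-size corrections to the free energy). [BorgsKotecky1990]
* M. Biskup, C. Borgs, J. T. Chayes, L. J. Kleinwaks, R. Kotecký, Comm. Math. Phys. 251 (2004)
  79–131, Assumption B(2) p. 8 (arXiv:math-ph/0304007). [BiskupBorgsChayesKleinwaksKotecky2004]
* S. Friedli, Y. Velenik, *Statistical Mechanics of Lattice Systems* (2017), §5.7.1. [FriedliVelenik2017]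
-/

noncomputable section

open Finset
open scoped BigOperators
open Literature.Probability.LatticeModels

namespace Summit.QuantumFields.YangMills.Cruxes.IRcof.TwistedSlab

namespace PolymerTorus

/-! ### The `k : 1` correspondence of short clusters and preservation of `Φ^T` -/

section ShortClusters

variable {k n N : ℕ} [NeZero n] [NeZero N] {Y : Type*} [Fintype Y] [DecidableEq Y]

omit [NeZero N] [Fintype Y] in
/-- **`Φ^T` is preserved by lifting**: if `w₂` agrees with `w₁` along the covering on `ℓ`-short
polymers and every member of `liftFam c C` is `ℓ`-short, then `Φ^T_{w₂}(liftFam c C) = Φ^T_{w₁}(C)`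
(relabeling invariance `truncatedWeight_image`; the lift is injective and respects `polyInc`).
[folklore] -/
theorem truncatedWeight_liftFam (hN : N = k * n) {ℓ : ℕ} {w₁ : Finset (ZMod n × Y) → ℂ}
    {w₂ : Finset (ZMod N × Y) → ℂ}
    (hloc : ∀ A : Finset (ZMod N × Y), IsTimeShort ℓ A → w₂ A = w₁ (projSet n A))
    {c : ZMod N} {C : Finset (Finset (ZMod n × Y))} (hshort : ∀ A ∈ C, IsTimeShort ℓ (liftSet c A)) :
    truncatedWeight polyInc w₂ (liftFam c C) = truncatedWeight polyInc w₁ C := by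
  unfold liftFam
  refine truncatedWeight_image (liftSet_injective hN c).injOn
    (fun A _ B _ => polyInc_liftSet_iff hN c A B) fun A hA => ?_
  rw [hloc _ (hshort A hA), projSet_liftSet hN]

open Classical in
/-- **The fibre of the covering over a short cluster**: the families upstairs with non-empty
`ℓ`-short support projecting onto a given family `C` downstairs, whose support is non-empty and
`ℓ`-short with base point `a`, are EXACTLY the `k` sheet lifts `liftFam (liftBase a + i n) C`,
`i < k` (`2ℓ ≤ n`: no mixed lifts). [folklore] -/
theorem filter_projFam_eq_image (hN : N = k * n) {ℓ : ℕ} (hℓ : 2 * ℓ ≤ n)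
    {C : Finset (Finset (ZMod n × Y))} {a : ZMod n}
    (ha : ∀ x ∈ clusterSupp C, (x.1 - a).val < ℓ) :
    (Finset.univ : Finset (Finset (Finset (ZMod N × Y)))).filter
        (fun C' => ((clusterSupp C').Nonempty ∧ IsTimeShort ℓ (clusterSupp C')) ∧ projFam n C' = C)
      = ((Finset.range k).image fun i => liftFam (liftBase N a + ((i * n : ℕ) : ZMod N)) C).filter
          fun C' => (clusterSupp C').Nonempty := by
  ext C'
  simp only [Finset.mem_filter, Finset.mem_univ, true_and, Finset.mem_image, Finset.mem_range]
  constructor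
  · rintro ⟨⟨hne, hshort⟩, hproj⟩
    refine ⟨?_, hne⟩
    have ha' : ∀ x ∈ clusterSupp C', ((ZMod.cast x.1 : ZMod n) - ZMod.cast (liftBase N a)).val < ℓ := by
      intro x hx
      rw [cast_liftBase hN]
      have hpx : proj n x ∈ clusterSupp C := by
        rw [← hproj, clusterSupp_projFam]
        exact Finset.mem_image_of_mem _ hx
      exact ha _ hpx
    obtain ⟨i, hi, hsheet⟩ := exists_sheet_of_isTimeShort hN hℓ hshort (liftBase N a) ha'
    refine ⟨i, hi, ?_⟩
    rw [← hproj]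
    exact liftFam_projFam_of_forall_val_lt hN fun x hx =>
      lt_of_lt_of_le (hsheet x hx) (by omega)
  · rintro ⟨⟨i, hi, rfl⟩, hne⟩
    refine ⟨⟨hne, ?_⟩, projFam_liftFam hN _ C⟩
    refine ⟨liftBase N a + ((i * n : ℕ) : ZMod N), fun y hy => ?_⟩
    rw [clusterSupp_liftFam] at hy
    refine val_sub_lt_of_mem_liftSet hN (fun x hx => ?_) hy
    rw [cast_liftBase_add hN]
    exact ha x hx

open Classical in
/-- **The short part of the cluster expansion upstairs is `k` times the short part downstairs**:
`Σ_{C' : supp C' ≠ ∅ short} Φ^T_{w₂}(C') = k · Σ_{C : supp C ≠ ∅ short} Φ^T_{w₁}(C)`. [cite: KoteckyPreiss1986, p. 493 (translation invariant case)] -/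
theorem sum_truncatedWeight_short_eq (hN : N = k * n) {ℓ : ℕ} (hℓ : 2 * ℓ ≤ n)
    {w₁ : Finset (ZMod n × Y) → ℂ} {w₂ : Finset (ZMod N × Y) → ℂ}
    (hloc : ∀ A : Finset (ZMod N × Y), IsTimeShort ℓ A → w₂ A = w₁ (projSet n A)) :
    ∑ C' ∈ (Finset.univ : Finset (Finset (Finset (ZMod N × Y)))) with
        ((clusterSupp C').Nonempty ∧ IsTimeShort ℓ (clusterSupp C')), truncatedWeight polyInc w₂ C'
      = (k : ℂ) * ∑ C ∈ (Finset.univ : Finset (Finset (Finset (ZMod n × Y)))) with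
          ((clusterSupp C).Nonempty ∧ IsTimeShort ℓ (clusterSupp C)), truncatedWeight polyInc w₁ C := by
  set 𝒮₂ := (Finset.univ : Finset (Finset (Finset (ZMod N × Y)))).filter
    fun C' => (clusterSupp C').Nonempty ∧ IsTimeShort ℓ (clusterSupp C') with h𝒮₂
  set 𝒮₁ := (Finset.univ : Finset (Finset (Finset (ZMod n × Y)))).filter
    fun C => (clusterSupp C).Nonempty ∧ IsTimeShort ℓ (clusterSupp C) with h𝒮₁
  have hmaps : ∀ C' ∈ 𝒮₂, projFam n C' ∈ 𝒮₁ := by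
    intro C' hC'
    obtain ⟨hne, hshort⟩ := (Finset.mem_filter.1 hC').2
    refine Finset.mem_filter.2 ⟨Finset.mem_univ _, ?_, ?_⟩
    · rw [clusterSupp_projFam]; exact hne.image _
    · rw [clusterSupp_projFam]; exact isTimeShort_projSet hN hshort
  rw [← Finset.sum_fiberwise_of_maps_to hmaps, Finset.mul_sum]
  refine Finset.sum_congr rfl fun C hC => ?_
  obtain ⟨hne, a, ha⟩ := (Finset.mem_filter.1 hC).2
  -- the fibre over `C` is the set of the `k` sheet lifts
  have hfib : 𝒮₂.filter (fun C' => projFam n C' = C) =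
      ((Finset.range k).image fun i => liftFam (liftBase N a + ((i * n : ℕ) : ZMod N)) C).filter
        fun C' => (clusterSupp C').Nonempty := by
    rw [h𝒮₂, Finset.filter_filter]
    exact filter_projFam_eq_image hN hℓ ha
  rw [hfib, Finset.filter_true_of_mem, Finset.sum_image]
  · rw [Finset.sum_congr rfl fun i hi => truncatedWeight_liftFam hN hloc (c := liftBase N a +
        ((i * n : ℕ) : ZMod N)) (C := C) fun A hA => ?_]
    · rw [Finset.sum_const, Finset.card_range, nsmul_eq_mul]
    · refine ⟨liftBase N a + ((i * n : ℕ) : ZMod N), fun y hy => ?_⟩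
      refine val_sub_lt_of_mem_liftSet hN (fun x hx => ?_) hy
      rw [cast_liftBase_add hN]
      exact ha x (subset_clusterSupp hA hx)
  · -- injectivity of the sheet lifts of the family (via their supports)
    intro i hi i' hi' h
    have hsupp := congrArg clusterSupp h
    simp only [clusterSupp_liftFam] at hsupp
    exact liftSet_sheet_injOn hN a hne hi hi' hsupp
  · intro C' hC'
    obtain ⟨i, _, rfl⟩ := Finset.mem_image.1 hC'
    rw [clusterSupp_liftFam]
    exact hne.image _

end ShortClusters

/-! ### The long (winding) clusters are exponentially small -/

section LongClusters

variable {N : ℕ} [NeZero N] {Y : Type*} [Fintype Y] [DecidableEq Y]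

/-- Double counting over the support: a non-negative function summed over families with
non-empty support is at most its sum over (site, family through the site). [folklore] -/
theorem sum_le_sum_sum_filter_mem_clusterSupp {𝓛 : Finset (Finset (Finset (ZMod N × Y)))}
    {g : Finset (Finset (ZMod N × Y)) → ℝ} (hg : ∀ C, 0 ≤ g C)
    (hne : ∀ C ∈ 𝓛, (clusterSupp C).Nonempty) :
    ∑ C ∈ 𝓛, g C ≤ ∑ x : ZMod N × Y, ∑ C ∈ 𝓛 with x ∈ clusterSupp C, g C := by
  classical
  calc ∑ C ∈ 𝓛, g C ≤ ∑ C ∈ 𝓛, ((clusterSupp C).card : ℝ) * g C := by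
        refine Finset.sum_le_sum fun C hC => le_mul_of_one_le_left (hg C) ?_
        exact_mod_cast Finset.card_pos.2 (hne C hC)
    _ = ∑ C ∈ 𝓛, ∑ x : ZMod N × Y, (if x ∈ clusterSupp C then g C else 0) := by
        refine Finset.sum_congr rfl fun C _ => ?_
        rw [Finset.sum_ite_mem, Finset.univ_inter, Finset.sum_const, nsmul_eq_mul]
    _ = ∑ x : ZMod N × Y, ∑ C ∈ 𝓛, (if x ∈ clusterSupp C then g C else 0) := Finset.sum_comm
    _ = ∑ x : ZMod N × Y, ∑ C ∈ 𝓛 with x ∈ clusterSupp C, g C := by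
        refine Finset.sum_congr rfl fun x _ => ?_
        rw [Finset.sum_filter]

open Classical in
/-- **The long clusters are exponentially small.** For activities on the subset polymers of
`X_N = ℤ_N × Y` supported on non-empty, time-connected (range `r`) polymers and obeying
hypothesis (1) of [KP86] with `d(A) ≥ δ|A|`, the families whose support is empty or NOT
`ℓ`-short contribute at most `e^{-δℓ/(2r)} Σ_x a{x}` to `log Ξ = Σ_C Φ^T(C)`: such a family with
`Φ^T ≠ 0` is a cluster of time-connected polymers, so its support is time-connected and long,
hence has `≥ ℓ/(2r)` sites, and (4) anchored at the one-site polymers bounds the clusters through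
a site of `d`-size `≥ δℓ/(2r)` by `e^{-δℓ/(2r)} a{x}`.
[cite: KoteckyPreiss1986, Theorem p. 492, estimate (4)] -/
theorem norm_sum_truncatedWeight_long_le {ℓ r : ℕ} {w : Finset (ZMod N × Y) → ℂ}
    {a d : Finset (ZMod N × Y) → ℝ} {δ : ℝ} (hδ : 0 ≤ δ)
    (hconn : ∀ A, w A ≠ 0 → A.Nonempty ∧ IsTimeConnected r A)
    (ha : ∀ A, 0 ≤ a A) (hd : ∀ A, δ * A.card ≤ d A)
    (hKP : ∀ A, ∑ A' ∈ Finset.univ with polyInc A' A, ‖w A'‖ * Real.exp (a A' + d A') ≤ a A) :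
    ‖∑ C ∈ (Finset.univ : Finset (Finset (Finset (ZMod N × Y)))) with
        ¬ ((clusterSupp C).Nonempty ∧ IsTimeShort ℓ (clusterSupp C)), truncatedWeight polyInc w C‖
      ≤ Real.exp (-(δ * ℓ / (2 * r))) * ∑ x : ZMod N × Y, a {x} := by
  have hd0 : ∀ A, 0 ≤ d A := fun A => (mul_nonneg hδ (Nat.cast_nonneg _)).trans (hd A)
  have h1 := kp_hypothesis_of_fintype (inc := polyInc) hKP
  have hfact := koteckyPreiss_truncatedWeight_bound_holds polyInc w a d
  have hKPvol : IsKPVolume polyInc w a (Finset.univ : Finset (Finset (ZMod N × Y))) :=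
    isKPVolume_of_tsum_le hd0 h1 _
  have hw0 : w ∅ = 0 := by
    by_contra h
    exact Finset.not_nonempty_empty (hconn ∅ h).1
  -- the long clusters with non-zero truncated functional
  set 𝓛 := (Finset.univ : Finset (Finset (Finset (ZMod N × Y)))).filter
    fun C => ¬ IsTimeShort ℓ (clusterSupp C) ∧ truncatedWeight polyInc w C ≠ 0 with h𝓛
  have h𝓛ne : ∀ C ∈ 𝓛, (clusterSupp C).Nonempty := fun C hC =>
    nonempty_of_not_isTimeShort (Finset.mem_filter.1 hC).2.1
  -- size of the long clusters
  have hsize : ∀ C ∈ 𝓛, δ * ℓ / (2 * r) ≤ ∑ A ∈ C, d A := by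
    intro C hC
    obtain ⟨hlong, hT⟩ := (Finset.mem_filter.1 hC).2
    have hCl : IsPolymerCluster polyInc C := by
      by_contra hCl
      exact hT (truncatedWeight_eq_zero_of_kp hKPvol (Finset.subset_univ C) hCl)
    have hmem : ∀ A ∈ C, w A ≠ 0 := fun A hA hA0 =>
      hT (truncatedWeight_eq_zero_of_mem_of_eq_zero hA hA0)
    have hconnS : IsTimeConnected r (clusterSupp C) :=
      isTimeConnected_clusterSupp hCl fun A hA => (hconn A (hmem A hA)).2
    have hcard := le_card_times_of_not_isTimeShort hconnS (h𝓛ne C hC) hlong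
    calc δ * ℓ / (2 * r) = δ * ((ℓ : ℝ) / (2 * r)) := by ring
      _ ≤ δ * ((clusterSupp C).card : ℝ) := by
          refine mul_le_mul_of_nonneg_left (hcard.trans ?_) hδ
          exact_mod_cast card_times_le _
      _ ≤ δ * ((∑ A ∈ C, A.card : ℕ) : ℝ) := by
          refine mul_le_mul_of_nonneg_left ?_ hδ
          exact_mod_cast card_clusterSupp_le_sum_card C
      _ = ∑ A ∈ C, δ * (A.card : ℝ) := by rw [Nat.cast_sum, Finset.mul_sum]
      _ ≤ ∑ A ∈ C, d A := Finset.sum_le_sum fun A _ => hd A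
  calc ‖∑ C ∈ Finset.univ with ¬ ((clusterSupp C).Nonempty ∧ IsTimeShort ℓ (clusterSupp C)),
          truncatedWeight polyInc w C‖
      ≤ ∑ C ∈ Finset.univ with ¬ ((clusterSupp C).Nonempty ∧ IsTimeShort ℓ (clusterSupp C)),
          ‖truncatedWeight polyInc w C‖ := norm_sum_le _ _
    _ = ∑ C ∈ (Finset.univ.filter fun C => ¬ ((clusterSupp C).Nonempty ∧
          IsTimeShort ℓ (clusterSupp C))) with ‖truncatedWeight polyInc w C‖ ≠ 0,
          ‖truncatedWeight polyInc w C‖ := (Finset.sum_filter_ne_zero _).symm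
    _ ≤ ∑ C ∈ 𝓛, ‖truncatedWeight polyInc w C‖ := by
        refine Finset.sum_le_sum_of_subset_of_nonneg (fun C hC => ?_) fun _ _ _ => norm_nonneg _
        simp only [Finset.mem_filter, Finset.mem_univ, true_and] at hC
        obtain ⟨hP, hT⟩ := hC
        rw [norm_ne_zero_iff] at hT
        refine Finset.mem_filter.2 ⟨Finset.mem_univ _, fun hshort => hP ⟨?_, hshort⟩, hT⟩
        rw [Finset.nonempty_iff_ne_empty]
        exact fun he => hT (truncatedWeight_eq_zero_of_clusterSupp_eq_empty hw0 he)
    _ ≤ ∑ x : ZMod N × Y, ∑ C ∈ 𝓛 with x ∈ clusterSupp C, ‖truncatedWeight polyInc w C‖ :=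
        sum_le_sum_sum_filter_mem_clusterSupp (fun _ => norm_nonneg _) h𝓛ne
    _ = ∑ x : ZMod N × Y, ∑ C ∈ 𝓛 with KPTouches polyInc C {x}, ‖truncatedWeight polyInc w C‖ := by
        refine Finset.sum_congr rfl fun x _ => ?_
        rw [Finset.filter_congr fun C _ => (kpTouches_polyInc_singleton_iff (C := C) (x := x)).symm]
    _ ≤ ∑ x : ZMod N × Y, Real.exp (-(δ * ℓ / (2 * r))) * a {x} := by
        refine Finset.sum_le_sum fun x _ => ?_
        exact sum_norm_truncatedWeight_le_exp_neg_of_touches hfact ha hd0 h1 𝓛 {x}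
          fun C hC _ => hsize C hC
    _ = Real.exp (-(δ * ℓ / (2 * r))) * ∑ x : ZMod N × Y, a {x} := by rw [Finset.mul_sum]

end LongClusters

/-! ### The theorem -/

section Main

variable {k n N : ℕ} [NeZero n] [NeZero N] {Y : Type*} [Fintype Y] [DecidableEq Y]

/-- **Torus doubling / `k`-fold covering for Kotecký–Preiss polymer gases.** Let `N = k n` and
let `w₂`, `w₁` be activities on the subset polymers of `X_N = ℤ_N × Y` and `X_n = ℤ_n × Y`
(incompatibility: equal or meeting) such that
* (locality) `w₂(A) = w₁(A mod n)` for every `A ⊆ X_N` whose times lie in an arc of `ℓ`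
  consecutive times, where `2ℓ ≤ n`;
* (connectedness) both are supported on non-empty polymers time-connected at range `r`;
* (Kotecký–Preiss) hypothesis (1) of [KP86] holds for each, with size functions `a ≥ 0` and `d`
  with `d(A) ≥ δ|A|`, `δ ≥ 0`.
Then the Kotecký–Preiss logarithms of the two partition functions (all polymers of the torus as
the volume) satisfy
`‖log Ξ(X_N; w₂) - k · log Ξ(X_n; w₁)‖ ≤ e^{-δℓ/(2r)} (Σ_{x ∈ X_N} a₂{x} + k · Σ_{x ∈ X_n} a₁{x})`.
For `k = 2`, `n = t` the Euclidean time period and `Y` the spatial data this is the statement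
that `log Ξ_{2t} - 2 log Ξ_t` is carried by the clusters winding around (or spanning half of) the
time circle. [cite: KoteckyPreiss1986, p. 493 (translation invariant case)] -/
theorem norm_polymerLogZ_sub_mul_polymerLogZ_le (hN : N = k * n) {ℓ r : ℕ} (hℓ : 2 * ℓ ≤ n)
    {w₁ : Finset (ZMod n × Y) → ℂ} {w₂ : Finset (ZMod N × Y) → ℂ}
    {a₁ d₁ : Finset (ZMod n × Y) → ℝ} {a₂ d₂ : Finset (ZMod N × Y) → ℝ} {δ : ℝ} (hδ : 0 ≤ δ)
    (hloc : ∀ A : Finset (ZMod N × Y), IsTimeShort ℓ A → w₂ A = w₁ (projSet n A))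
    (hconn₁ : ∀ A, w₁ A ≠ 0 → A.Nonempty ∧ IsTimeConnected r A)
    (hconn₂ : ∀ A, w₂ A ≠ 0 → A.Nonempty ∧ IsTimeConnected r A)
    (ha₁ : ∀ A, 0 ≤ a₁ A) (hd₁ : ∀ A, δ * A.card ≤ d₁ A)
    (hKP₁ : ∀ A, ∑ A' ∈ Finset.univ with polyInc A' A, ‖w₁ A'‖ * Real.exp (a₁ A' + d₁ A') ≤ a₁ A)
    (ha₂ : ∀ A, 0 ≤ a₂ A) (hd₂ : ∀ A, δ * A.card ≤ d₂ A)
    (hKP₂ : ∀ A, ∑ A' ∈ Finset.univ with polyInc A' A, ‖w₂ A'‖ * Real.exp (a₂ A' + d₂ A') ≤ a₂ A) :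
    ‖polymerLogZ polyInc w₂ (Finset.univ : Finset (Finset (ZMod N × Y))) -
        (k : ℂ) * polymerLogZ polyInc w₁ (Finset.univ : Finset (Finset (ZMod n × Y)))‖
      ≤ Real.exp (-(δ * ℓ / (2 * r))) *
          (∑ x : ZMod N × Y, a₂ {x} + k * ∑ x : ZMod n × Y, a₁ {x}) := by
  classical
  set P₂ : Finset (Finset (ZMod N × Y)) → Prop :=
    fun C => (clusterSupp C).Nonempty ∧ IsTimeShort ℓ (clusterSupp C) with hP₂
  set P₁ : Finset (Finset (ZMod n × Y)) → Prop :=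
    fun C => (clusterSupp C).Nonempty ∧ IsTimeShort ℓ (clusterSupp C) with hP₁
  set S₂ := ∑ C ∈ Finset.univ with P₂ C, truncatedWeight polyInc w₂ C with hS₂
  set R₂ := ∑ C ∈ Finset.univ with ¬ P₂ C, truncatedWeight polyInc w₂ C with hR₂
  set S₁ := ∑ C ∈ Finset.univ with P₁ C, truncatedWeight polyInc w₁ C with hS₁
  set R₁ := ∑ C ∈ Finset.univ with ¬ P₁ C, truncatedWeight polyInc w₁ C with hR₁
  have h₂ : polymerLogZ polyInc w₂ (Finset.univ : Finset (Finset (ZMod N × Y))) = S₂ + R₂ := by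
    rw [polymerLogZ_eq_sum_truncatedWeight, Finset.powerset_univ, hS₂, hR₂,
      Finset.sum_filter_add_sum_filter_not]
  have h₁ : polymerLogZ polyInc w₁ (Finset.univ : Finset (Finset (ZMod n × Y))) = S₁ + R₁ := by
    rw [polymerLogZ_eq_sum_truncatedWeight, Finset.powerset_univ, hS₁, hR₁,
      Finset.sum_filter_add_sum_filter_not]
  have hshort : S₂ = (k : ℂ) * S₁ := sum_truncatedWeight_short_eq hN hℓ hloc
  have hR₂le : ‖R₂‖ ≤ Real.exp (-(δ * ℓ / (2 * r))) * ∑ x : ZMod N × Y, a₂ {x} :=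
    norm_sum_truncatedWeight_long_le hδ hconn₂ ha₂ hd₂ hKP₂
  have hR₁le : ‖R₁‖ ≤ Real.exp (-(δ * ℓ / (2 * r))) * ∑ x : ZMod n × Y, a₁ {x} :=
    norm_sum_truncatedWeight_long_le hδ hconn₁ ha₁ hd₁ hKP₁
  rw [h₂, h₁, hshort]
  calc ‖(k : ℂ) * S₁ + R₂ - (k : ℂ) * (S₁ + R₁)‖ = ‖R₂ - (k : ℂ) * R₁‖ := by ring_nf
    _ ≤ ‖R₂‖ + ‖(k : ℂ) * R₁‖ := norm_sub_le _ _
    _ = ‖R₂‖ + k * ‖R₁‖ := by rw [norm_mul, Complex.norm_natCast]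
    _ ≤ Real.exp (-(δ * ℓ / (2 * r))) * ∑ x : ZMod N × Y, a₂ {x} +
          k * (Real.exp (-(δ * ℓ / (2 * r))) * ∑ x : ZMod n × Y, a₁ {x}) :=
        add_le_add hR₂le (mul_le_mul_of_nonneg_left hR₁le (Nat.cast_nonneg k))
    _ = _ := by ring


/-- **Torus doubling** (`k = 2`, `ℓ = ⌊n/2⌋`): under the hypotheses of
`norm_polymerLogZ_sub_mul_polymerLogZ_le` with the activities agreeing along the double cover on
every polymer whose times lie in an arc of `⌊n/2⌋` consecutive times,
`‖log Ξ(ℤ_{2n} × Y; w₂) - 2 · log Ξ(ℤ_n × Y; w₁)‖ ≤ e^{-δ⌊n/2⌋/(2r)} (Σ_{x ∈ X_{2n}} a₂{x} + 2 Σ_{x ∈ X_n} a₁{x})`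
— the form (m6) `|log Ξ_{2t} - 2 log Ξ_t| ≤ A · t · |Y| · e^{-c t}` of the memo, the winding
clusters being the only difference between the `2t`-tube and two `t`-tubes.
[cite: BorgsKotecky1990, §1 (periodic boundary conditions: exponentially small finite-size corrections)] -/
theorem norm_polymerLogZ_double_sub_two_mul_le (hN : N = 2 * n) {r : ℕ}
    {w₁ : Finset (ZMod n × Y) → ℂ} {w₂ : Finset (ZMod N × Y) → ℂ}
    {a₁ d₁ : Finset (ZMod n × Y) → ℝ} {a₂ d₂ : Finset (ZMod N × Y) → ℝ} {δ : ℝ} (hδ : 0 ≤ δ)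
    (hloc : ∀ A : Finset (ZMod N × Y), IsTimeShort (n / 2) A → w₂ A = w₁ (projSet n A))
    (hconn₁ : ∀ A, w₁ A ≠ 0 → A.Nonempty ∧ IsTimeConnected r A)
    (hconn₂ : ∀ A, w₂ A ≠ 0 → A.Nonempty ∧ IsTimeConnected r A)
    (ha₁ : ∀ A, 0 ≤ a₁ A) (hd₁ : ∀ A, δ * A.card ≤ d₁ A)
    (hKP₁ : ∀ A, ∑ A' ∈ Finset.univ with polyInc A' A, ‖w₁ A'‖ * Real.exp (a₁ A' + d₁ A') ≤ a₁ A)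
    (ha₂ : ∀ A, 0 ≤ a₂ A) (hd₂ : ∀ A, δ * A.card ≤ d₂ A)
    (hKP₂ : ∀ A, ∑ A' ∈ Finset.univ with polyInc A' A, ‖w₂ A'‖ * Real.exp (a₂ A' + d₂ A') ≤ a₂ A) :
    ‖polymerLogZ polyInc w₂ (Finset.univ : Finset (Finset (ZMod N × Y))) -
        2 * polymerLogZ polyInc w₁ (Finset.univ : Finset (Finset (ZMod n × Y)))‖
      ≤ Real.exp (-(δ * (n / 2 : ℕ) / (2 * r))) *
          (∑ x : ZMod N × Y, a₂ {x} + 2 * ∑ x : ZMod n × Y, a₁ {x}) := by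
  have h := norm_polymerLogZ_sub_mul_polymerLogZ_le (k := 2) hN (ℓ := n / 2) (by omega) hδ hloc
    hconn₁ hconn₂ ha₁ hd₁ hKP₁ ha₂ hd₂ hKP₂
  simp only [Nat.cast_ofNat] at h
  exact h

end Main

end PolymerTorus

end Summit.QuantumFields.YangMills.Cruxes.IRcof.TwistedSlab
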